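import Summits.RiemannHypothesis.RiemannHypothesis.Theorems.JensenLogBandXiStripMajorant
import Literature.NumberTheory.LFunctions.ZetaClassicalRegionBounds
import HarnessLib

/-!
# A `ζ`-bound across the strip in `ℓ`-form (BAND line, flank input)

RH ladder column JENSEN, rung J-P(P3) «log band», BAND crux `XiDerivBandRealAllRates` of route
«JensenLogBand», line «band-one-window» (u-arc, top-shell reshape), lead rh-jensen-prover g8.
RH-FREE classical analysis. WHAT THIS IS NOT: nothing here bears on zeros of `ζ` off the line or the
truth of RH.

On the flanks of the right half-arc the TRUE integrand is the `ζ`-free model times `ζ(½+u)`, and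
the arc dips into the critical strip. What the flank estimate consumes is a bound of `‖ζ(σ+it)‖`
whose growth in the strip is written against the SAME scale `log(t/2π)/2` that governs the descent
of the model (`Re γ̃′/γ̃ = ℓ_t/2 + O(1/t)`):

  `‖ζ(σ+it)‖ ≤ (1 + 1/δ) · 672 log t · exp((1+δ−σ)₊ · (log((1+δ+t)/2π)/2 + 6/t))`
  (`0 < σ`, `0 < δ ≤ 1`, `t ≥ 12`; `LogBandArc.norm_riemannZeta_le_strip_ell`).

Right of `1+δ` this is `‖ζ‖ ≤ σ/(σ−1) ≤ 1 + 1/δ` (tree `ZetaClassicalRegion.norm_riemannZeta_le_of_one_lt_re`);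
left of it, it is eng-2 g6's strip majorant `‖ξ(s)‖ ≤ 672 log t ‖γ̃(1+δ+it)‖` (F2,
`LogBandArc.norm_riemannXi_le_strip_majorant'`) divided by `‖γ̃(s)‖`, with the horizontal comparison
`‖γ̃(1+δ+it)‖ ≤ ‖γ̃(σ+it)‖ e^{(1+δ−σ)(log((1+δ+t)/2π)/2 + 6/t)}` (F1,
`LogBandArc.norm_xiGammaFactor_le_of_le_re`).
-/

noncomputable section

-- single-problem summit: `Summit.RiemannHypothesis.RiemannHypothesis.…` is the tree convention
set_option linter.dupNamespace false

open Complex Real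

namespace Summit.RiemannHypothesis.RiemannHypothesis.Theorems.JensenPolynomials.LogBandArc

open Literature.NumberTheory.LFunctions

/-- `log t ≥ 1` for `t ≥ 12` (so `672 log t ≥ 1`). [folklore] -/
theorem one_le_log_of_twelve_le {t : ℝ} (ht : 12 ≤ t) : 1 ≤ Real.log t := by
  have he : Real.exp 1 ≤ 12 := by have := Real.exp_one_lt_d9; linarith
  calc (1 : ℝ) = Real.log (Real.exp 1) := (Real.log_exp 1).symm
    _ ≤ Real.log t := Real.log_le_log (Real.exp_pos 1) (he.trans ht)

/-- **`ζ` across the strip in `ℓ`-form.** For `s = σ + it` with `σ > 0`, `t ≥ 12` and `0 < δ ≤ 1`: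
`‖ζ(s)‖ ≤ (1 + 1/δ)·(672 log t)·exp((1+δ−σ)₊·(log((1+δ+t)/2π)/2 + 6/t))`. [folklore] -/
theorem norm_riemannZeta_le_strip_ell {s : ℂ} {δ : ℝ} (hσ : 0 < s.re) (hδ : 0 < δ) (hδ1 : δ ≤ 1)
    (ht : 12 ≤ s.im) :
    ‖riemannZeta s‖ ≤ (1 + 1 / δ) * (672 * Real.log s.im) *
      Real.exp (max (1 + δ - s.re) 0 * (Real.log ((1 + δ + s.im) / (2 * π)) / 2 + 6 / s.im)) := by
  have hlog1 : 1 ≤ Real.log s.im := one_le_log_of_twelve_le ht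
  have hA : 1 ≤ (1 + 1 / δ) * (672 * Real.log s.im) := by
    have h1 : (1 : ℝ) ≤ 1 + 1 / δ := by have := one_div_pos.2 hδ; linarith
    nlinarith
  -- the rate `Λ = log((1+δ+t)/2π)/2 + 6/t` is nonnegative (indeed ≥ 0.3)
  have hΛ : 0 ≤ Real.log ((1 + δ + s.im) / (2 * π)) / 2 + 6 / s.im := by
    have h1 : 0 ≤ Real.log ((1 + δ + s.im) / (2 * π)) := by
      apply Real.log_nonneg
      rw [le_div_iff₀ (by positivity)]
      linarith [Real.pi_lt_d2]
    have h2 : 0 ≤ 6 / s.im := by positivity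
    linarith
  have hs_eq : s = ((s.re : ℝ) : ℂ) + (s.im : ℂ) * I := (Complex.re_add_im s).symm.trans (by simp)
  rcases le_or_gt (1 + δ) s.re with hright | hleft
  · -- right of `1 + δ`: `‖ζ(s)‖ ≤ σ/(σ−1) ≤ 1 + 1/δ`
    have hs1 : 1 < s.re := by linarith
    have h1 : ‖riemannZeta s‖ ≤ s.re / (s.re - 1) :=
      ZetaClassicalRegion.norm_riemannZeta_le_of_one_lt_re hs1
    have h2 : s.re / (s.re - 1) ≤ 1 + 1 / δ := by
      rw [div_le_iff₀ (by linarith)]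
      have hδ' : 0 < s.re - 1 := by linarith
      have : 1 / δ * (s.re - 1) ≥ 1 := by
        rw [one_div_mul_eq_div, ge_iff_le, le_div_iff₀ hδ]; linarith
      nlinarith
    have hmax : max (1 + δ - s.re) 0 = 0 := max_eq_right (by linarith)
    rw [hmax, zero_mul, Real.exp_zero, mul_one]
    calc ‖riemannZeta s‖ ≤ 1 + 1 / δ := h1.trans h2
      _ ≤ (1 + 1 / δ) * (672 * Real.log s.im) := by
          have h3 : (1 : ℝ) ≤ 672 * Real.log s.im := by nlinarith
          have h4 : 0 ≤ 1 + 1 / δ := by have := one_div_pos.2 hδ; linarith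
          nlinarith
  · -- inside `0 < σ < 1 + δ`: strip majorant over `‖γ̃(s)‖`, horizontal comparison
    have hmax : max (1 + δ - s.re) 0 = 1 + δ - s.re := max_eq_left (by linarith)
    rw [hmax]
    have hs1 : s ≠ 1 := by
      intro h; rw [h] at ht; simp at ht; linarith
    have hγ0 : xiGammaFactor s ≠ 0 := xiGammaFactor_ne_zero hσ hs1
    have hγpos : 0 < ‖xiGammaFactor s‖ := norm_pos_iff.2 hγ0
    -- F2
    have hF2 : ‖riemannXi s‖ ≤ 672 * Real.log s.im *
        ‖xiGammaFactor (((1 + δ : ℝ) : ℂ) + s.im * I)‖ :=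
      norm_riemannXi_le_strip_majorant' hσ.le hleft.le hδ hδ1 ht
    -- F1 (horizontal, from `σ` to `1 + δ` at height `t`)
    have hF1 : ‖xiGammaFactor (((1 + δ : ℝ) : ℂ) + s.im * I)‖ ≤
        ‖xiGammaFactor ((s.re : ℂ) + s.im * I)‖ *
          Real.exp ((1 + δ - s.re) * (Real.log ((1 + δ + s.im) / (2 * π)) / 2 + 6 / s.im)) :=
      norm_xiGammaFactor_le_of_le_re hσ hleft.le (by linarith)
    rw [← hs_eq] at hF1
    -- `‖ξ(s)‖ = ‖γ̃(s)‖ ‖ζ(s)‖`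
    have hfac : ‖riemannXi s‖ = ‖xiGammaFactor s‖ * ‖riemannZeta s‖ := norm_riemannXi_eq_mul hσ hs1
    -- divide by `‖γ̃(s)‖`
    have hkey : ‖xiGammaFactor s‖ * ‖riemannZeta s‖ ≤ ‖xiGammaFactor s‖ *
        ((672 * Real.log s.im) *
          Real.exp ((1 + δ - s.re) * (Real.log ((1 + δ + s.im) / (2 * π)) / 2 + 6 / s.im))) := by
      rw [← hfac]
      calc ‖riemannXi s‖ ≤ 672 * Real.log s.im * ‖xiGammaFactor (((1 + δ : ℝ) : ℂ) + s.im * I)‖ := hF2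
        _ ≤ 672 * Real.log s.im * (‖xiGammaFactor s‖ *
              Real.exp ((1 + δ - s.re) * (Real.log ((1 + δ + s.im) / (2 * π)) / 2 + 6 / s.im))) :=
            mul_le_mul_of_nonneg_left hF1 (by positivity)
        _ = _ := by ring
    have h1 := le_of_mul_le_mul_left hkey hγpos
    calc ‖riemannZeta s‖ ≤ (672 * Real.log s.im) *
          Real.exp ((1 + δ - s.re) * (Real.log ((1 + δ + s.im) / (2 * π)) / 2 + 6 / s.im)) := h1
      _ ≤ (1 + 1 / δ) * (672 * Real.log s.im) *
          Real.exp ((1 + δ - s.re) * (Real.log ((1 + δ + s.im) / (2 * π)) / 2 + 6 / s.im)) := by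
          have h4 : (1 : ℝ) ≤ 1 + 1 / δ := by have := one_div_pos.2 hδ; linarith
          have h5 : 0 ≤ (672 * Real.log s.im) *
              Real.exp ((1 + δ - s.re) * (Real.log ((1 + δ + s.im) / (2 * π)) / 2 + 6 / s.im)) := by
            positivity
          nlinarith

end Summit.RiemannHypothesis.RiemannHypothesis.Theorems.JensenPolynomials.LogBandArc

end
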